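import Literature.AnabelianGeometry.EtaleTheta.Discharge.Sec2GaloisDictionaryOfSetting
import Literature.AnabelianGeometry.EtaleTheta.FrobenioidKummerOut
import Mathlib.FieldTheory.Galois.Infinite

/-!
# [EtTh] §5, Lemma 5.8: the geometric-connectedness step `hgc` («a unit of `B_N` commuting with `s^⊓-gp_N(Π^tp_Y)` is a constant of `K`») REDUCED to the constants of `B_N` read in `ℚ̄_p` (Galois descent) (p. 331 / PDF p. 105)

Mochizuki, *The étale theta function and its Frobenioid-theoretic manifestations*, Publ. RIMS **45** (2009), Lemma 5.8
p.331 (PDF p.105): "`(O_K^×)^{1/N} := (K^×)^{1/N} ∩ O^×(B_N)` … the set of elements of `O^×(B_N)` on which `Π^tp_Y` [i.e., `G_K`,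
via the natural surjection `Π^tp_Y ↠ G_K`] acts …" — the action of `Π^tp_Y` on the units of `B_N` FACTORS THROUGH `G_K` because
"[`Y`] is geometrically connected over `K`" (§5 p.322 (PDF p.96): "each of which is geometrically connected over the field
`K = K̈`"); Def. 3.6 (iii)/(iv) p.304 (PDF p.78): the constants `K` of the tempered Frobenioid and its base-field hull `C^{bs-fld}`.
[cite: MochizukiEtTh2009, Lem 5.8 p.331 (PDF p.105)].  Layer L2 of the abc-iut cell, seat abc-iut-L2-t11 (gen 4); GAP-LEDGER row
**G-L2t4-4** (`hgc`, owner abc-iut-L2-t4: "needs the function-field structure of `O^×(B_N^birat)` (constant field = `K`,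
geometric connectedness of the covering)"), self-named by this seat 2026-08-26T10:25Z with first refusal to the owner.  PROOF-ONLY
(0 defs; nothing landed is edited).

WHAT IS PROVED.  abc-iut-L2-t4's binder (hypothesis `hgc` of `ThetaFrobenioid.facts_ofConnectedTemperoidData` /
`facts_ofThetaSettingData`, stated here for ANY §5 data `𝔉`):
  `∀ u : O^×(B_N), (∀ y ∈ Im(Π^tp_Y̲), s^⊓-gp_N(y) · u · s^⊓-gp_N(y)⁻¹ = u) → u ∈ K^× ⊆ O^×(B_N^birat)`
FOLLOWS (`hgc_of_constantsDictionary`) from the «constants of `B_N` read in `ℚ̄_p`» dictionary — the SAME junction datum under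
which this seat's Lemma 5.9 (iv) files (`Sec5Lem59ivOfSettingDictionary.lean`, p437577) are stated, extended from `(K^×)^{1/N}` to
a subgroup of constants containing the units: binders `Cst ≤ O^×(B_N^birat)` with `O^×(B_N) ⊆ Cst` (Prop. 3.4 (ii)/Def. 3.3:
an element with trivial divisor is constant) and `K^× ⊆ Cst`, stable under the natural action of `s^⊓-gp_N(ρ(y))`,
`ν̃ : Cst →* ℚ̄_p^×` INJECTIVE and `G_K`-EQUIVARIANT against abc-iut-L2-t8's model of the setting (`T := Cu.thetaEnvData μ hC hS` at
level `𝔉.N` along `ι`: the birational action of `s^⊓-gp_N(ρ(y))` is the Galois action of `aug(ι y) ∈ G_K ≤ Gal(ℚ̄_p/ℚ_p)`), and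
reaching `K` (every element of `K^×` is `ν̃` of a constant `constEmb k`).  ROUTE (print's "geometrically connected over `K`" read
as Galois descent): invariance under `Im(Π^tp_Y̲)` ⇒ `ν̃(u)` is fixed by `aug(Π^tp_Y̲̲) = G_K` (`thetaEnvData_augY_surjective`, this
seat's gen-3 `Sec2GaloisDictionaryOfSetting.lean`, + `IdentifiesPiY`) ⇒ `ν̃(u) ∈ ℚ̄_p^{G_K} = K` (Mathlib's infinite Galois
correspondence `InfiniteGalois.fixedField_fixingSubgroup`) ⇒ `u` is the constant it reads (injectivity).  Also recorded:
`act_sgpCap_unitsToBirat_eq_of_conj_eq` (the invariance hypothesis read on `O^×(B_N^birat)`) and `smul_eq_self_of_forall_PiY`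
(fixed by all of `G_K`); v2 (append-only): `hsurj_of_constantsDictionary` — Lemma 5.8's "`(K^×)^{1/N} → K^×` onto" (abc-iut-L2-t4's
`hsurj`, whence their `kxRootNModCyclotome_ofThetaSettingData_of_surj`) from the same dictionary.  NET for the census: GAP G-L2t4-4 joins G-L2t11-1, G-L2t11-2 and F-1306 under ONE junction field family
«constants of `B_N` in `ℚ̄_p`, `G_K`-equivariantly» ([EtTh] Def. 3.6 (iv) `C^{bs-fld}`).
HONEST FRAMING: a kernel-checked REDUCTION over the typed §5 interface; the dictionary is a hypothesis (no such datum is constructed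
for an actual curve in the tree); nothing of [EtTh] is asserted unconditionally; typed ≠ proved; no side is taken on anything
downstream ([IUTchIII] Cor. 3.12).
-/

noncomputable section

namespace Literature.AnabelianGeometry.EtaleTheta

open CategoryTheory Literature.AnabelianGeometry.SemiGraphs
open scoped Pointwise

universe w u u' v'

namespace ThetaFrobenioid

variable {C₀ : Type u} [Category.{0} C₀] {D₀ : Type u'} [Category.{v'} D₀] {𝔉 : ThetaFrobenioid.{w} C₀ D₀}

namespace BiratAutAction

variable (α : 𝔉.BiratAutAction)
  {p : ℕ} [Fact p.Prime] {D : ThetaSetting p} {E : D.EtaleThetaData} {l : ℕ} (Cu : E.DoubleUnderline l)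
  (μ : D.CyclotomeMod l 𝔉.N) (hC : D.Compat) (hS : D.Sec2Hyps)
  (ι : 𝔉.PiX ≃ₜ* (Cu.thetaEnvData μ hC hS).PiX)

/-- The invariance hypothesis of `hgc` read on `O^×(B_N^birat)`: if `s^⊓-gp_N(y) · u · s^⊓-gp_N(y)⁻¹ = u` then the natural action
of `s^⊓-gp_N(y)` fixes the image of `u` in `O^×(B_N^birat)` (equivariance of "the natural inclusion" `O^×(B_N) ↪ O^×(B_N^birat)`,
Lemma 5.8).  [cite: MochizukiEtTh2009, Lem 5.8 p.331 (PDF p.105)] -/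
theorem act_sgpCap_unitsToBirat_eq_of_conj_eq (u : 𝔉.units 𝔉.BN) (a : Aut (𝔉.base.obj 𝔉.BN))
    (hu : 𝔉.sgpCap a * (u : Aut 𝔉.BN) * (𝔉.sgpCap a)⁻¹ = u) :
    α.act (𝔉.sgpCap a) (𝔉.unitsToBirat 𝔉.BN u) = 𝔉.unitsToBirat 𝔉.BN u := by
  rw [α.act_unitsToBirat]
  congr 1
  exact Subtype.ext hu

/-- **Fixed by all of `G_K`** ("`Π^tp_Y` [i.e., `G_K`, via the natural surjection `Π^tp_Y ↠ G_K`] acts"): a `ℚ̄_p^×`-valued reading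
that is `G_K`-equivariant against the model of the setting and invariant under `Im(Π^tp_Y̲)` is fixed by every element of `G_K` —
`Π^tp_Y̲̲ ↠ G_K` is onto (this seat's `thetaEnvData_augY_surjective`) and `ι` identifies `Π^tp_Y̲` with `Π^tp_Y̲̲` (`IdentifiesPiY`).
[cite: MochizukiEtTh2009, Lem 5.8 proof p.331 (PDF p.105)] -/
theorem smul_eq_self_of_forall_PiY (hY : 𝔉.IdentifiesPiY (Cu.thetaEnvData μ hC hS) ι.toMulEquiv)
    (z : 𝔉.PiX → (PadicAlgCl p)ˣ) (c : (PadicAlgCl p)ˣ)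
    (hz : ∀ y ∈ 𝔉.PiY, (((Cu.thetaEnvData μ hC hS).aug (ι y) : D.GK) : GQp p) • c = z y)
    (hinv : ∀ y ∈ 𝔉.PiY, z y = c) (σ : D.GK) : (σ : GQp p) • c = c := by
  obtain ⟨q, hq⟩ := Cu.thetaEnvData_augY_surjective μ hC hS σ
  have hy : ι.symm (q : (Cu.thetaEnvData μ hC hS).PiX) ∈ 𝔉.PiY := by
    refine (hY _).mpr ?_
    change ι (ι.symm (q : (Cu.thetaEnvData μ hC hS).PiX)) ∈ (Cu.thetaEnvData μ hC hS).PiY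
    rw [ι.apply_symm_apply]
    exact q.2
  have h := hz _ hy
  rw [hinv _ hy, ι.apply_symm_apply] at h
  rw [← hq]
  exact h

/-- **GAP G-L2t4-4 `hgc` REDUCED to the constants-in-`ℚ̄_p` dictionary** — abc-iut-L2-t4's binder of
`facts_ofConnectedTemperoidData` / `facts_ofThetaSettingData` VERBATIM for any §5 data: "a unit of `B_N` commuting with
`s^⊓-gp_N(Im Π^tp_Y)` is a constant of `K`" (Lemma 5.8: `(O_K^×)^{1/N} = (K^×)^{1/N} ∩ O^×(B_N)`, "`Π^tp_Y` [i.e., `G_K` …] acts",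
"geometrically connected over `K`").  Hypotheses: the natural action `α`; a subgroup `Cst ≤ O^×(B_N^birat)` of constants containing
`O^×(B_N)` (`hU`; Prop. 3.4 (ii)) and stable under `s^⊓-gp_N(ρ(y))` (`hact`); an INJECTIVE reading `ν̃ : Cst →* ℚ̄_p^×` that is
`G_K`-EQUIVARIANT against abc-iut-L2-t8's model of the setting (`hequiv`) and REACHES `K` on the constants `constEmb` (`hKc`, `hνK`);
the identification `hY` of `Π^tp_Y̲`.  Conclusion by Galois descent `ℚ̄_p^{G_K} = K` (`InfiniteGalois.fixedField_fixingSubgroup`).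
[cite: MochizukiEtTh2009, Lem 5.8 p.331 (PDF p.105)] -/
theorem hgc_of_constantsDictionary (hY : 𝔉.IdentifiesPiY (Cu.thetaEnvData μ hC hS) ι.toMulEquiv)
    (Cst : Subgroup (𝔉.biratUnits 𝔉.BN)) (hU : ∀ u : 𝔉.units 𝔉.BN, 𝔉.unitsToBirat 𝔉.BN u ∈ Cst)
    (hKc : ∀ k : 𝔉.Kˣ, 𝔉.constEmb k ∈ Cst)
    (hact : ∀ (y : 𝔉.PiX) (x : 𝔉.biratUnits 𝔉.BN), x ∈ Cst → α.act (𝔉.sgpCap (𝔉.ρ y)) x ∈ Cst)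
    (ν' : Cst →* (PadicAlgCl p)ˣ) (hinj : Function.Injective ν')
    (hequiv : ∀ (y : 𝔉.PiX) (x : Cst),
      ν' ⟨α.act (𝔉.sgpCap (𝔉.ρ y)) x, hact y x x.2⟩ = (((Cu.thetaEnvData μ hC hS).aug (ι y) : D.GK) : GQp p) • ν' x)
    (hνK : ∀ z : (D.K)ˣ, ∃ k : 𝔉.Kˣ,
      ((ν' ⟨𝔉.constEmb k, hKc k⟩ : (PadicAlgCl p)ˣ) : PadicAlgCl p) = algebraMap D.K (PadicAlgCl p) (z : D.K)) :
    ∀ u : 𝔉.units 𝔉.BN, (∀ y ∈ 𝔉.imPiY, 𝔉.sgpCap y * (u : Aut 𝔉.BN) * (𝔉.sgpCap y)⁻¹ = u) →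
      𝔉.unitsToBirat 𝔉.BN u ∈ 𝔉.constEmb.range := by
  intro u hu
  -- the unit read in `ℚ̄_p`
  set x : Cst := ⟨𝔉.unitsToBirat 𝔉.BN u, hU u⟩ with hx
  -- invariance under `Im(Π^tp_Y̲)` read through `ν'`
  have hinv : ∀ y ∈ 𝔉.PiY, (((Cu.thetaEnvData μ hC hS).aug (ι y) : D.GK) : GQp p) • ν' x = ν' x := by
    intro y hy
    rw [← hequiv y x]
    congr 1
    apply Subtype.ext
    exact α.act_sgpCap_unitsToBirat_eq_of_conj_eq u (𝔉.ρ y) (hu (𝔉.ρ y) (Subgroup.mem_map_of_mem 𝔉.ρ hy))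
  -- hence fixed by all of `G_K`
  have hfix : ∀ σ : D.GK, (σ : GQp p) • ν' x = ν' x :=
    smul_eq_self_of_forall_PiY Cu μ hC hS ι hY (fun _ => ν' x) (ν' x) hinv (fun _ _ => rfl)
  -- hence `ν'(u) ∈ ℚ̄_p^{G_K} = K`
  have hmem : ((ν' x : (PadicAlgCl p)ˣ) : PadicAlgCl p) ∈ D.K := by
    haveI : IsGalois ℚ_[p] (PadicAlgCl p) := {}
    rw [← InfiniteGalois.fixedField_fixingSubgroup D.K, IntermediateField.mem_fixedField_iff]
    intro σ hσ
    have h := congrArg (fun w : (PadicAlgCl p)ˣ => (w : PadicAlgCl p)) (hfix ⟨σ, hσ⟩)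
    simp only [AlgEquiv.smul_units_def, Units.coe_map, MonoidHom.coe_coe] at h
    exact h
  -- read off the constant of `K`
  have hne : (⟨((ν' x : (PadicAlgCl p)ˣ) : PadicAlgCl p), hmem⟩ : D.K) ≠ 0 := fun h0 =>
    (ν' x).ne_zero (congrArg Subtype.val h0)
  obtain ⟨k, hk⟩ := hνK (Units.mk0 _ hne)
  have hk' : ν' ⟨𝔉.constEmb k, hKc k⟩ = ν' x := Units.ext hk
  exact ⟨k, congrArg Subtype.val (hinj hk')⟩

/-- **Lemma 5.8's surjectivity clause `hsurj` FROM THE SAME DICTIONARY**: "the `N`-th power map `(K^×)^{1/N} → K^×` is onto" (the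
first clause of abc-iut-L2-t4's `KxRootNModCyclotome`, their binder `hsurj` of `kxRootNModCyclotome_ofConnectedTemperoidData_of_surj`
/ `…_ofThetaSettingData_of_surj`): every constant `k ∈ K^×` has an `N`-th root in `O^×(B_N^birat)` — because the reading `ν̃` is
injective, sends the constants of `𝔉` into `K` (`hνK'`), and the constants of `B_N` contain an `N`-th root of every element of `K`
(`hνN`: `B_N` is `(l,N)`-theta-saturated, Def. 5.4; its base field contains `K(k^{1/N})`).  v2 (append-only).
[cite: MochizukiEtTh2009, Lem 5.8 p.331 (PDF p.105)] -/
theorem hsurj_of_constantsDictionary (Cst : Subgroup (𝔉.biratUnits 𝔉.BN)) (hKc : ∀ k : 𝔉.Kˣ, 𝔉.constEmb k ∈ Cst)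
    (hKx : 𝔉.KxRootN ≤ Cst) (ν' : Cst →* (PadicAlgCl p)ˣ) (hinj : Function.Injective ν')
    (hνK' : ∀ k : 𝔉.Kˣ, ((ν' ⟨𝔉.constEmb k, hKc k⟩ : (PadicAlgCl p)ˣ) : PadicAlgCl p) ∈ D.K)
    (hνN : ∀ y : (D.K)ˣ, ∃ f : 𝔉.KxRootN,
      ((ν' ⟨(f : 𝔉.biratUnits 𝔉.BN), hKx f.2⟩ : (PadicAlgCl p)ˣ) : PadicAlgCl p) ^ (𝔉.N : ℕ) =
        algebraMap D.K (PadicAlgCl p) (y : D.K)) :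
    ∀ k : 𝔉.Kˣ, ∃ f ∈ 𝔉.KxRootN, f ^ (𝔉.N : ℕ) = 𝔉.constEmb k := by
  intro k
  have hne : (⟨((ν' ⟨𝔉.constEmb k, hKc k⟩ : (PadicAlgCl p)ˣ) : PadicAlgCl p), hνK' k⟩ : D.K) ≠ 0 := fun h0 =>
    (ν' ⟨𝔉.constEmb k, hKc k⟩).ne_zero (congrArg Subtype.val h0)
  obtain ⟨f, hf⟩ := hνN (Units.mk0 _ hne)
  refine ⟨f, f.2, ?_⟩
  have hpow : ν' (⟨(f : 𝔉.biratUnits 𝔉.BN), hKx f.2⟩ ^ (𝔉.N : ℕ)) = ν' ⟨𝔉.constEmb k, hKc k⟩ := by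
    rw [map_pow]
    exact Units.ext (by rw [Units.val_pow_eq_pow_val]; exact hf)
  exact congrArg Subtype.val (hinj hpow)

end BiratAutAction

end ThetaFrobenioid

end Literature.AnabelianGeometry.EtaleTheta

end
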